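import Summits.AtomisticToContinuum.FouriersLaw.Theses.StaticAbelianSqueeze
import Summits.AtomisticToContinuum.FouriersLaw.Theorems.LatticeLandauDampingAbelThermodynamicLimitAutocorrIntegrableOn
import HarnessLib

/-!
# `stub_fixedNAbelRegularity` of line `Sketch` (zero-mean-dyadic-splice): at FIXED `N` the Abel
deficit of the open chain vanishes as `ν ↓ 0`
(crux `StaticAbelianSqueeze.UniformAbelianRegularity` = (R), item stmt-AtomisticToContinuum-13416;
`--supports` helper file proving the registered analysis stub `stub_fixedNAbelRegularity` of
composition B of the line; closes nothing)

For the OPEN pinned anharmonic chain `P = pinnedChain ω₂ lam β γ` (all parameters `> 0`) with both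
Langevin baths at temperature `T > 0`, write `J = Σ_i j_i` for the total bond current,
`c_N(t) = ∫ J · (P_t J) dμ_{N,T}` for its equilibrium autocorrelation (Gibbs measure
`gibbsMeasure N T`, constructed kernels `transitionKernel N T T t`) and

  `S_N(ν) = ∫₀^∞ (1 − e^{−νt}) c_N(t) dt`

for the Abel deficit.  **Theorem (`stub_fixedNAbelRegularity`).** For every fixed `N`,
`S_N(ν) → 0` as `ν ↓ 0`.

Proof.  Pure dominated convergence (`tendsto_abelDeficit_of_integrableOn`): `c_N` is integrable on
`(0, ∞)` at every fixed `N` (LANDED, `SeriesLawAtEveryLaplaceFrequency.stub_autocorrIntegrableOn`,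
p144688 — exponential convergence to equilibrium of Cuneo–Eckmann–Hairer–Rey-Bellet 2018 at an
`N`-dependent rate); for `ν > 0`, `t > 0` the weight satisfies `0 ≤ 1 − e^{−νt} ≤ 1`, so `|c_N|`
dominates, and pointwise `(1 − e^{−νt}) c_N(t) → (1 − e^0) c_N(t) = 0` as `ν → 0` by continuity of
`exp`; the filter `𝓝[>] 0` is countably generated.

References: Bonetto–Lebowitz–Rey-Bellet 2000 §7 (the Green–Kubo/Abel set-up); CEHR 2018 Thm 2.13.
No named fact is used; nothing here closes the item.
-/

noncomputable section

namespace Summit.AtomisticToContinuum.FouriersLaw.Theorems.UniformAbelianRegularity.ZeroMeanDyadicSplice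

open MeasureTheory Set Filter Topology

/-- **Abel deficit of an integrable function vanishes at low frequency.** If `c` is integrable on
`(0, ∞)` then `∫₀^∞ (1 − e^{−νt}) c(t) dt → 0` as `ν ↓ 0`: dominated convergence with the bound
`|c|` (for `ν, t > 0`, `0 ≤ 1 − e^{−νt} ≤ 1`) and the pointwise limit `(1 − e^0) c(t) = 0`. -/
theorem tendsto_abelDeficit_of_integrableOn {c : ℝ → ℝ} (hc : IntegrableOn c (Ioi 0)) :
    Tendsto (fun ν : ℝ => ∫ t in Ioi (0:ℝ), (1 - Real.exp (-(ν * t))) * c t) (𝓝[>] 0) (𝓝 0) := by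
  have key : Tendsto (fun ν : ℝ => ∫ t in Ioi (0:ℝ), (1 - Real.exp (-(ν * t))) * c t) (𝓝[>] 0)
      (𝓝 (∫ t in Ioi (0:ℝ), (1 - Real.exp (-(0 * t))) * c t)) := by
    refine tendsto_integral_filter_of_dominated_convergence (fun t => ‖c t‖) ?_ ?_ hc.norm ?_
    · exact Eventually.of_forall fun ν =>
        (Continuous.aestronglyMeasurable (by fun_prop)).mul hc.aestronglyMeasurable
    · filter_upwards [self_mem_nhdsWithin] with ν hν
      refine (ae_restrict_iff' measurableSet_Ioi).2 (Eventually.of_forall fun t ht => ?_)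
      have hν0 : (0:ℝ) < ν := hν
      have ht0 : (0:ℝ) < t := ht
      have h1 : Real.exp (-(ν * t)) ≤ 1 := Real.exp_le_one_iff.2 (by nlinarith [mul_pos hν0 ht0])
      have h2 : 0 < Real.exp (-(ν * t)) := Real.exp_pos _
      rw [norm_mul, Real.norm_eq_abs, abs_of_nonneg (by linarith : (0:ℝ) ≤ 1 - Real.exp (-(ν * t)))]
      exact mul_le_of_le_one_left (norm_nonneg _) (by linarith)
    · refine Eventually.of_forall fun t => tendsto_nhdsWithin_of_tendsto_nhds ?_
      have hcont : Continuous fun ν : ℝ => (1 - Real.exp (-(ν * t))) * c t := by fun_prop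
      exact hcont.tendsto 0
  simpa using key

/-- **Registered stub `stub_fixedNAbelRegularity` of line `Sketch`** (composition B of the crux
`UniformAbelianRegularity`, item stmt-AtomisticToContinuum-13416): for `pinnedChain ω₂ lam β γ`
(all `> 0`), `T > 0` and EVERY fixed `N`, the Abel deficit
`S_N(ν) = ∫₀^∞ (1 − e^{−νt}) c_N(t) dt` of the total-current autocorrelation
`c_N(t) = ∫ J · (P_t J) dμ_{N,T}` tends to `0` as `ν ↓ 0` — dominated convergence
(`tendsto_abelDeficit_of_integrableOn`) from the landed fixed-`N` integrability of `c_N`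
(`SeriesLawAtEveryLaplaceFrequency.stub_autocorrIntegrableOn`, p144688). -/
theorem stub_fixedNAbelRegularity : ∀ ω₂ lam β γ : ℝ, 0 < ω₂ → 0 < lam → 0 < β → 0 < γ → ∀ T : ℝ, 0 < T → ∀ N : ℕ, let J : Literature.MathematicalPhysics.KineticTheory.HeatConduction.PhaseSpace N → ℝ := fun z => ∑ i : Fin N, (Literature.MathematicalPhysics.KineticTheory.HeatConduction.pinnedChain ω₂ lam β γ).bondCurrent N i z; Filter.Tendsto (fun ν : ℝ => ∫ t in Set.Ioi (0:ℝ), (1 - Real.exp (-(ν * t))) * ∫ z, J z * (∫ y, J y ∂((Literature.MathematicalPhysics.KineticTheory.HeatConduction.pinnedChain ω₂ lam β γ).transitionKernel N T T t.toNNReal z)) ∂((Literature.MathematicalPhysics.KineticTheory.HeatConduction.pinnedChain ω₂ lam β γ).gibbsMeasure N T)) (nhdsWithin (0:ℝ) (Set.Ioi 0)) (nhds 0) := by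
  intro ω₂ lam β γ hω hl hβ hγ T hT N J
  set P := Literature.MathematicalPhysics.KineticTheory.HeatConduction.pinnedChain ω₂ lam β γ
    with hP_def
  set cN : ℝ → ℝ := fun t =>
    ∫ z, J z * (∫ y, J y ∂(P.transitionKernel N T T t.toNNReal z)) ∂(P.gibbsMeasure N T)
    with hcN_def
  show Tendsto (fun ν : ℝ => ∫ t in Ioi (0:ℝ), (1 - Real.exp (-(ν * t))) * cN t) (𝓝[>] 0) (𝓝 0)
  -- fixed-`N` integrability of `c_N` (LANDED, p144688)
  have hint : IntegrableOn cN (Ioi 0) :=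
    Summit.AtomisticToContinuum.FouriersLaw.Theorems.AbelThermodynamicLimit.SeriesLawAtEveryLaplaceFrequency.stub_autocorrIntegrableOn
      ω₂ lam β γ hω hl hβ hγ T hT N
  exact tendsto_abelDeficit_of_integrableOn hint

end Summit.AtomisticToContinuum.FouriersLaw.Theorems.UniformAbelianRegularity.ZeroMeanDyadicSplice
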